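import Summits.QuantumFields.BalabanUV.T4Continuum.Support.NE7HdecompOfDirectLettersFM
import Summits.QuantumFields.BalabanUV.T4Continuum.Support.NE7HintOfSliceNormalisationSU2DecSlice
import HarnessLib

/-!
# NE7HintOfDirectLettersSU2FM — STEP 0 (memo ROAD-G102 §9), fourth file: ROW NE7's END OF RECORD OVER THE TWO DIRECT LETTERS, with the WEAKER letter hypothesis `hDL′` (the letters asked only for
# slice representatives with matched frames `framePotW(T(u)) = h(u)` and zero defect `Df(u) = 0`) — `NE7HintOfDirectLettersSU2.hint_SU2_of_directLetters` VERBATIM otherwise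

Cell `pub-balaban`, rung (B)+1 sub-cell t4, lineage `b2b-balaban-t4-ne7-p1`, generation 102 (CRUX PROVER NE7 #1 = OWNER of BINDER row NE7).  Memo `t4/b2b-balaban-t4-ne7-p1-g102/ROAD-G102.md` §9.
WHAT ([folklore]; 0 def, 0 sorry).  **`hint_SU2_of_directLetters_fm`**.  THIS is the END of record to cite: HINT(SU(2), d = 4, L = 2) ⇐ the k-free strict line ∧ `hDL′`.
HONEST FRAMING (page 1): composition; `hDL′` and the line are HYPOTHESES asserted for nothing; nothing of Bałaban's asserted; NE7 NOT PROVED; spine 0∕9; finite T⁴ rung (B)+1 — NOT infinite volume, NOT mass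
gap, NOT BetaPertH, NOT Clay.  Continuum YM on T⁴ ⇐ BetaPertH ∧ nine spine estimates (0/9 proved); BetaPertH ⇐ (D1) ∧ (D4) ∧ CAP+tail; G-an2-4 gates asym, D1 and NE2/3/4.
-/


set_option autoImplicit false

open scoped BigOperators Matrix Matrix.Norms.L2Operator
open NormedSpace Finset Set

namespace Summit.QuantumFields.BalabanUV.T4Continuum.NE7HintOfDirectLettersSU2FM

open Literature.MathematicalPhysics.QuantumFieldTheory.Balaban1983to89
open B7Prop1Explicit B7Prop2Explicit MatrixLog
open T4AveragingDeficitWall (IsUnitaryCfg IsSkewDir SmallField vary curl curlSq dirSq dirL1)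
open T4AveragingDeficitWallBoundary (IsPeriodicCfg periodBox)
open AveragingDeficitPeriodicCounting (IsPeriodicDir)
open AveragingDeficitMultiLevelPrep (LevelSmall tower TangentIter cavgIter)
open MinimalActionLevels (perWin)
open MinimalActionSandwich (IsMinimiser admissible)
open MinimalActionRate (sfClass)
open NE3HessForm (dAction)
open NE3SlicePoincareBudgetLine (CPLine)
open NE3EnergyShapes (IsUnitarySite IsPeriodicSite)
open NE3EnergyWeightedShapes (energyNormW)
open NE3QbarIterCovLiftPrep (cruxC)
open NE3SmoothRightInverseW (rightInvW)
open NE3RightInverseSolveLetters (thetaLoc)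
open NE3RightInverseL2Letter (l2C)
open NE3HatInvCurlLetters (curl2C curl1C)
open NE3LinearisedAverageSup (curvSum)
open BlockAverageVaryDisc (rho0)
open NE7MeanZeroGaugeSliceW (energyBlockLandauW)
open NE7SliceIterationState (repLog cornerLog coarseDatum)
open NE3TangentCovariantTower (framePotW)
open NE7SliceIterationState (tangentPart sliceDefect)
open NE7HdecompOfDirectLettersFM (hdecomp_of_directLetters_fm)
open NE7HintOfSliceNormalisationSU2DecSlice (hint_SU2_of_decomposition)

noncomputable section

variable {n : Type} [Fintype n] [DecidableEq n]

/-- **ROW NE7's END OF RECORD OVER THE TWO DIRECT LETTERS** (SU(2)∕U(2): `card n = 2`; `d = 4`, `L = 2`): there are `ℓ ≥ 1`, a k-free `C_S > 0` and `ε₀ > 0` such that for `0 < ε ≤ ε₀` there is `β₀ > 0`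
with: for every `0 < β ≤ β₀`, `N ≥ 1`, `q₂ ≥ 0`, `q₁`, IF the k-free strict line holds with the ceilings `α̂ := C_S·ε`, `ν̂ := √(l2C 4 2∕(1 − θ_ℓε)² + curl2C 4 2∕(1 − θ_ℓε)²)·q₂`,
`κ̂ := ε·(curl1C 4 2∕(1 − θ_ℓε))·q₁` (`θ_ℓ = thetaLoc 4 2`), AND the two direct letters `hDL(q₂, q₁)` hold for the coarse datum of every slice representative (shape of
`NE7HdecompOfDirectLetters.hdecomp_of_directLetters`), THEN HINT: ∃ δV > 0 such that every unitary `N`-periodic `δV`-small datum `V` has, at every level `k`, a minimiser of the `(k, ε)`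
constrained problem that is STRICTLY small-field. [folklore] -/
theorem hint_SU2_of_directLetters_fm [Nonempty n] (hn : Fintype.card n = 2) :
    ∃ ℓ : ℕ, 1 ≤ ℓ ∧ ∃ CS : ℝ, 0 < CS ∧ ∃ ε₀ : ℝ, 0 < ε₀ ∧ ∀ ε : ℝ, 0 < ε → ε ≤ ε₀ → ∃ β₀ : ℝ, 0 < β₀ ∧ ∀ β : ℝ, 0 < β → β ≤ β₀ →
    ∀ (N : ℕ) [NeZero N] (q₂ q₁ : ℝ), 1 ≤ N → 0 ≤ q₂ →
    -- ONE k-free strict line, at the ceilings `α̂ = C_S ε`, `ν̂(q₂, ε)`, `κ̂(q₁, ε)`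
    2 * (ε * (curl1C 4 2 / (1 - thetaLoc 4 2 * ε)) * q₁)
      < ((((1 / 2 - (Real.sqrt (l2C 4 2 / (1 - thetaLoc 4 2 * ε) ^ 2 + curl2C 4 2 / (1 - thetaLoc 4 2 * ε) ^ 2) * q₂) ^ 2) / (2 * (1 + (8 * CPLine 4 2 2 (1 / 10 ^ 17) (1 / 10 ^ 53) + 1)))
          - (Real.sqrt (l2C 4 2 / (1 - thetaLoc 4 2 * ε) ^ 2 + curl2C 4 2 / (1 - thetaLoc 4 2 * ε) ^ 2) * q₂) ^ 2) / 2
          - 576 * ((4 : ℕ) : ℝ) * ((CS * ε) ^ 2 * Real.exp (2 * (CS * ε)))) / (Fintype.card n : ℝ) - 28 * ((4 : ℕ) : ℝ) * (ε + 7 * (CS * ε) ^ 2)) →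
    -- (S2): THE TWO DIRECT LETTERS for the coarse datum of every slice representative
    (∀ (k : ℕ) (Us U' : Site 4 → Fin 4 → (Matrix n n ℂ)ˣ) (u : Site 4 → (Matrix n n ℂ)ˣ),
        IsUnitaryCfg Us → IsPeriodicCfg Us ((tower 2 N (k + 1) : ℕ) : ℤ) → SmallField Us (ε / (((2 : ℕ) : ℝ) ^ (k + 1)) ^ 2) →
        IsUnitaryCfg U' → IsPeriodicCfg U' ((tower 2 N (k + 1) : ℕ) : ℤ) → SmallField U' (ε / (((2 : ℕ) : ℝ) ^ (k + 1)) ^ 2) →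
        cavgIter 2 (k + 1) U' = cavgIter 2 (k + 1) Us →
        LevelSmall 4 2 k (ε / (((2 : ℕ) : ℝ) ^ (k + 1)) ^ 2) → LevelSmall 4 2 (k + 1) (ε / (((2 : ℕ) : ℝ) ^ (k + 1)) ^ 2) →
        cruxC 4 2 * ((((2 : ℕ) : ℝ) ^ (k + 1)) ^ 2 * (ε / (((2 : ℕ) : ℝ) ^ (k + 1)) ^ 2)) < 1 → curvSum 4 2 (k + 1) (ε / (((2 : ℕ) : ℝ) ^ (k + 1)) ^ 2) ≤ 2 / 3 * (2 : ℕ) →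
        4 * (3 + 12 * ((4 : ℕ) : ℝ)) ^ 2 * ((2 : ℕ) : ℝ) ^ (k + 1) * (CS * ε / ((2 : ℕ) : ℝ) ^ (k + 1)) ≤ rho0 4 2 ^ 2 →
        IsUnitarySite u → IsPeriodicSite u ((tower 2 N (k + 1) : ℕ) : ℤ) → gaugeAct u U' = vary Us (repLog Us U' u) 1 →
        (∀ (y : Site 4) (κ : Fin 4), ((2 : ℕ) : ℝ) ^ (k + 1) * ‖repLog Us U' u y κ‖ ≤ CS * ε) →
        (∀ z : Site 4, ((u ((((2 : ℕ) : ℤ)) ^ (k + 1) • z) : (Matrix n n ℂ)ˣ) : Matrix n n ℂ) = exp (cornerLog 2 k u z)) → (∀ z : Site 4, ‖cornerLog 2 k u z‖ ≤ CS * ε) →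
        (∀ (hWu' : IsUnitaryCfg Us) (hx' : 0 ≤ ε / (((2 : ℕ) : ℝ) ^ (k + 1)) ^ 2) (hs' : LevelSmall 4 2 k (ε / (((2 : ℕ) : ℝ) ^ (k + 1)) ^ 2))
            (hWx' : SmallField Us (ε / (((2 : ℕ) : ℝ) ^ (k + 1)) ^ 2)) (hθ' : cruxC 4 2 * ((((2 : ℕ) : ℝ) ^ (k + 1)) ^ 2 * (ε / (((2 : ℕ) : ℝ) ^ (k + 1)) ^ 2)) < 1)
            (hφ : IsSkewDir (coarseDatum 2 k Us U' u)),
          (fun y μ => repLog Us U' u y μ - rightInvW (le_refl 2) k hWu' hx' hs' hWx' N hθ' hφ y μ) ∈ energyBlockLandauW (d := 4) (n := n) 2 N (k + 1) Us) →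
        (∀ (hWu' : IsUnitaryCfg Us) (hx' : 0 ≤ ε / (((2 : ℕ) : ℝ) ^ (k + 1)) ^ 2) (hs' : LevelSmall 4 2 k (ε / (((2 : ℕ) : ℝ) ^ (k + 1)) ^ 2))
            (hWx' : SmallField Us (ε / (((2 : ℕ) : ℝ) ^ (k + 1)) ^ 2)) (hθ' : cruxC 4 2 * ((((2 : ℕ) : ℝ) ^ (k + 1)) ^ 2 * (ε / (((2 : ℕ) : ℝ) ^ (k + 1)) ^ 2)) < 1),
          (∀ z : Site 4, framePotW 2 (k + 1) Us (tangentPart (le_refl 2) k hWu' hx' hs' hWx' N hθ' U' u) z = cornerLog 2 k u z) ∧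
            sliceDefect (le_refl 2) k hWu' hx' hs' hWx' N hθ' U' u = 0) →
        (((2 : ℕ) : ℝ) ^ (k + 1)) ^ 4 / (((2 : ℕ) : ℝ) ^ (k + 1)) ^ 4 * dirSq (coarseDatum 2 k Us U' u) (periodBox (d := 4) N)
            ≤ q₂ ^ 2 * energyNormW 2 (k + 1) Us (repLog Us U' u) (periodBox (d := 4) (N * 2 ^ (k + 1))) ^ 2 ∧
          (((2 : ℕ) : ℝ) ^ (k + 1)) ^ 4 / (((2 : ℕ) : ℝ) ^ (k + 1)) ^ 4 * dirL1 (coarseDatum 2 k Us U' u) (periodBox (d := 4) N)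
            ≤ q₁ * energyNormW 2 (k + 1) Us (repLog Us U' u) (periodBox (d := 4) (N * 2 ^ (k + 1))) ^ 2) →
    ∃ δV : ℝ, 0 < δV ∧
      ∀ V ∈ {V : Site 4 → Fin 4 → (Matrix n n ℂ)ˣ | IsUnitaryCfg V ∧ IsPeriodicCfg V (N : ℤ) ∧ SmallField V δV},
      ∀ k : ℕ, ∃ U : Site 4 → Fin 4 → (Matrix n n ℂ)ˣ, IsMinimiser 4 (sfClass 4 2 N ε) 2 N k V U ∧
        ∃ a : ℝ, 0 ≤ a ∧ a < ε / (((2 : ℕ) : ℝ) ^ k) ^ 2 ∧ SmallField U a := by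
  obtain ⟨ℓ, hℓ, ε₀, hε₀, H⟩ := hint_SU2_of_decomposition (n := n) hn
  obtain ⟨ε₂, hε₂, CS, hCS, HJ⟩ := hdecomp_of_directLetters_fm (n := n)
  refine ⟨ℓ, hℓ, CS, hCS, min ε₀ ε₂, lt_min hε₀ hε₂, fun ε hε hεle => ?_⟩
  obtain ⟨β₀, hβ₀, H2⟩ := H ε hε (hεle.trans (min_le_left _ _))
  refine ⟨β₀, hβ₀, fun β hβ hβle N _ q₂ q₁ hN hq₂ hline hDL => ?_⟩
  exact H2 β hβ hβle N (CS * ε) _ _ hN hline (HJ N ε hε (hεle.trans (min_le_right _ _)) β q₂ q₁ hq₂ hDL)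

end

end Summit.QuantumFields.BalabanUV.T4Continuum.NE7HintOfDirectLettersSU2FM
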